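import Summits.Ventures.QEC.Census.CertPopcount
import Summits.Ventures.QEC.Census.CertBZChunks
import HarnessLib

/-!
# Fast-leaf kernel replays of the Brouwer–Zimmermann enumeration ⇒ type-10's verdicts
# (plan/CERT-FORMAT.md v1.1 §5.3 C4; qec-search-10 «BZ144 SIZING INPUT» 2026-08-26)

`Census/CertPopcount.lean` provides the byte-parallel leaf `bzLeafFast B wmax allow` (≈ 7× cheaper in the kernel than
`bzLeaf` on 144-bit words) and `bzLeaf_of_fast` (fast leaf ⇒ leaf, pointwise on words below `2^(8B)`). This file
lifts it to whole replays and to the verdict shapes the emitted files use: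

* `reaches_bzLeaf_of_fast` — a replay (`Reaches`, type-10 `CertScan`) that passes with the fast leaf passes with
  the original leaf, provided every position word and the start word are below `2^N ≤ 2^(8B)`;
* `matrixEnumOK_of_chunk1_fast`, `DistCert.bzZEnum_of_chunk1_fast` / `bzXEnum_of_chunk1_fast` — the level-1 chunk
  assembly of `Census/CertBZChunks.lean` with FAST chunk facts (`chunk1R (bzLeafFast B w allow) (rowPos G 0) …` by
  `decide +kernel`) concluding `matrixEnumOK` / `c.bzZEnum z b i = true` in type-10's exact vocabulary, so
  `CertBZInfoSets.bzZBlock_of_parts` and the soundness theorems apply unchanged.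

Generic; no `decide` run here; axioms standard.
-/

namespace Summit.Ventures.QEC.Census

/-! ## Position lists of row words -/

/-- The second components of `rowPos G j` are entries of `G`. -/
theorem snd_mem_of_mem_rowPos : ∀ (G : List ℕ) (j : ℕ) (p : ℕ × ℕ), p ∈ rowPos G j → p.2 ∈ G
  | [], _, p, hp => by simp [rowPos] at hp
  | g :: gs, j, p, hp => by
    simp only [rowPos, List.mem_cons] at hp
    rcases hp with rfl | hp
    · simp
    · exact List.mem_cons_of_mem _ (snd_mem_of_mem_rowPos gs (j + 1) p hp)

/-- The second component of `(rowPos G j).getD i (0,0)` is `G.getD i 0`. -/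
theorem snd_getD_rowPos : ∀ (G : List ℕ) (j i : ℕ), ((rowPos G j).getD i (0, 0)).2 = G.getD i 0
  | [], _, i => by simp [rowPos]
  | g :: gs, j, 0 => by simp [rowPos]
  | g :: gs, j, i + 1 => by
    simp only [rowPos, List.getD_cons_succ]
    exact snd_getD_rowPos gs (j + 1) i

/-- Every entry (or the default `0`) of a list of words below `2^N` is below `2^N`. -/
theorem getD_lt_of_forall_lt {G : List ℕ} {N : ℕ} (hG : ∀ g ∈ G, g < 2 ^ N) (i : ℕ) : G.getD i 0 < 2 ^ N := by
  rw [List.getD_eq_getElem?_getD]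
  cases h : G[i]? with
  | none => simp
  | some g => simpa using hG g (List.mem_of_getElem? h)

/-! ## Fast replays imply replays -/

/-- **A replay passing with the fast leaf passes with type-10's leaf**, when the position words of `L` and the
start word `s` are below `2^N` with `N ≤ 8B`, `B ≤ 31` (so every reached codeword is a word of at most `B` bytes). -/
theorem reaches_bzLeaf_of_fast {B wmax : ℕ} {allow : List ℕ} (hB : B ≤ 31) {N : ℕ} (hN : N ≤ 8 * B)
    {L : List (ℕ × ℕ)} (hL : ∀ p ∈ L, p.2 < 2 ^ N) {b v s : ℕ} (hs : s < 2 ^ N)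
    (h : Reaches (bzLeafFast B wmax allow) L b v s) : Reaches (bzLeaf wmax allow) L b v s := by
  intro S hS hlen
  have hx : xorSnd S < 2 ^ N := by
    refine xorList_lt N _ fun x hx => ?_
    rw [List.mem_map] at hx
    obtain ⟨p, hp, rfl⟩ := hx
    exact hL p (hS.subset hp)
  have hc : s ^^^ xorSnd S < 2 ^ (8 * B) :=
    lt_of_lt_of_le (Nat.xor_lt_two_pow hs hx) (Nat.pow_le_pow_right (by norm_num) hN)
  exact bzLeaf_of_fast hB hc (h S hS hlen)

/-- **Level-1 FAST chunks ⇒ the matrix verdict** (cf. `matrixEnumOK_of_chunk1`): rows `G = giRows Gb mt` all below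
`2^N` (`hlt`, a `decide` on the literal), `N ≤ 8B`, `B ≤ 31`, depth `mt.t = t + 1`, and for every row index `i < |G|`
the fast replay of budget `t` after row `i` reaches every sublist ⇒ `matrixEnumOK wmax allow Gb mt = true`. -/
theorem matrixEnumOK_of_chunk1_fast {wmax : ℕ} {allow Gb : List ℕ} {mt : BZMatrix} (G : List ℕ) (hG : giRows Gb mt = G)
    {t : ℕ} (ht : mt.t = t + 1) (n : ℕ) (hn : G.length = n) {B N : ℕ} (hB : B ≤ 31) (hN : N ≤ 8 * B)
    (hlt : (G.all fun g => decide (g < 2 ^ N)) = true)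
    (h : ∀ i, i < n → Reaches (bzLeafFast B wmax allow) ((rowPos G 0).drop (i + 1)) t
      ((rowPos G 0).getD i (0, 0)).1 ((rowPos G 0).getD i (0, 0)).2) :
    matrixEnumOK wmax allow Gb mt = true := by
  have hG' : ∀ g ∈ G, g < 2 ^ N := by
    intro g hg
    rw [List.all_eq_true] at hlt
    simpa using hlt g hg
  refine matrixEnumOK_of_chunk1 G hG ht n hn fun i hi => reaches_bzLeaf_of_fast hB hN ?_ ?_ (h i hi)
  · intro p hp
    exact hG' _ (snd_mem_of_mem_rowPos G 0 p (List.mem_of_mem_drop hp))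
  · rw [snd_getD_rowPos]
    exact getD_lt_of_forall_lt hG' i

namespace DistCert

variable (c : DistCert) (z : BZData)

/-- **`Z` side, block `b`, matrix `i` from FAST level-1 chunks** (cf. `bzZEnum_of_chunk1`). -/
theorem bzZEnum_of_chunk1_fast {b i : ℕ} {blk : BZBlock} {mt : BZMatrix}
    (hb : z.sideZ.blocks[b]? = some blk) (hi : blk.mats[i]? = some mt)
    (G : List ℕ) (hG : giRows (gbRows c.HZ z.rcZ z.LZ blk) mt = G)
    (w : ℕ) (hw : c.dZ - 1 = w) (allow : List ℕ) (hallow : c.sideZ.found.map Prod.fst = allow)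
    {t : ℕ} (ht : mt.t = t + 1) (n : ℕ) (hn : G.length = n) {B N : ℕ} (hB : B ≤ 31) (hN : N ≤ 8 * B)
    (hlt : (G.all fun g => decide (g < 2 ^ N)) = true)
    (h : ∀ j, j < n → Reaches (bzLeafFast B w allow) ((rowPos G 0).drop (j + 1)) t
      ((rowPos G 0).getD j (0, 0)).1 ((rowPos G 0).getD j (0, 0)).2) :
    c.bzZEnum z b i = true := by
  simp only [bzZEnum, hb, hi]
  rw [hw, hallow]
  exact matrixEnumOK_of_chunk1_fast G hG ht n hn hB hN hlt h

/-- **`X` side, block `b`, matrix `i` from FAST level-1 chunks** (roles exchanged). -/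
theorem bzXEnum_of_chunk1_fast {b i : ℕ} {blk : BZBlock} {mt : BZMatrix}
    (hb : z.sideX.blocks[b]? = some blk) (hi : blk.mats[i]? = some mt)
    (G : List ℕ) (hG : giRows (gbRows c.HX z.rcX z.LX blk) mt = G)
    (w : ℕ) (hw : c.dX - 1 = w) (allow : List ℕ) (hallow : c.sideX.found.map Prod.fst = allow)
    {t : ℕ} (ht : mt.t = t + 1) (n : ℕ) (hn : G.length = n) {B N : ℕ} (hB : B ≤ 31) (hN : N ≤ 8 * B)
    (hlt : (G.all fun g => decide (g < 2 ^ N)) = true)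
    (h : ∀ j, j < n → Reaches (bzLeafFast B w allow) ((rowPos G 0).drop (j + 1)) t
      ((rowPos G 0).getD j (0, 0)).1 ((rowPos G 0).getD j (0, 0)).2) :
    c.bzXEnum z b i = true := by
  simp only [bzXEnum, hb, hi]
  rw [hw, hallow]
  exact matrixEnumOK_of_chunk1_fast G hG ht n hn hB hN hlt h

end DistCert

/-! ## Control: the Steane certificate, `X` side, first matrix, with the fast leaf (`B = 1` byte, `N = 7`) -/

/-- Control (Steane `[[7,1,3]]`, `X` side, block 0, matrix 0): the verdict from four FAST level-1 chunks packed as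
one `chunk1R` range (the emitted files' term shape; words of 7 bits = 1 byte). -/
theorem bzXEnum_certSteane7_fast : certSteane7.bzXEnum bzSteane 0 0 = true :=
  DistCert.bzXEnum_of_chunk1_fast certSteane7 bzSteane (b := 0) (i := 0) rfl rfl
    (giRows (gbRows certSteane7.HX bzSteane.rcX bzSteane.LX (bzSteane.sideX.blocks[0]'(by decide)))
      ((bzSteane.sideX.blocks[0]'(by decide)).mats[0]'(by decide))) (by decide)
    2 (by decide) (certSteane7.sideX.found.map Prod.fst) rfl (t := 0) (by decide) 4 (by decide)
    (B := 1) (N := 7) (by norm_num) (by norm_num) (by decide)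
    (forall_lt_append forall_lt_zero
      (forall_of_chunk1R (test := bzLeafFast 1 2 (certSteane7.sideX.found.map Prod.fst)) (b := 0) (i0 := 0) (len := 4)
        (by decide)))

end Summit.Ventures.QEC.Census
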